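import Summits.Langlands.Langlands.Theses.ParityBlindBianchi
import Summits.Langlands.Langlands.Theorems.ParityBlindBianchiResidualBianchiDoorMod2TwoAdicModel
import Summits.Langlands.Langlands.Theorems.IcosahedralDescentLevel.Negative.AllParityOfDoorOfDescent

/-!
# `ResidualBianchiDoorLevel` (E1′, stmt-Langlands-15112) as typed is exactly "regular algebraic
# cuspidal automorphic representations of `GL₂` exist over every 2-split imaginary quadratic field"

Negative-side lemmas (refuter cdisprove seat, 2026-08-16; supports stmt-Langlands-15112; does NOT
refute the crux — it explains why the crux as typed cannot be refuted and what its content is).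

The conclusion of `ParityBlindBianchi.ResidualBianchiDoorLevel` binds `∃ S₀ : Finset ℕ, 2 ∈ S₀ ∧ …`
with `S₀` NOT restricted to primes, and a place `v` is good iff `∀ ℓ ∈ S₀, ((ℓ : ℕ) : 𝓞 K) ∉ v`.
With `S₀ = {2, 0}` no place is good (`IcosahedralDescentLevel.Negative.no_good_place_of_zero_mem`),
the congruence clause is vacuous, the 2-adic model `σ` of `ρ|_K` with finite image, irreducible,
projective image `A₅` is unconditional (`ResidualBianchiDoorMod2.exists_padicModel_restrictField`),
and what is left of E1′ is one regular algebraic cuspidal `π₀` on `GL₂(𝔸_K)` per field `K`.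

* `isIrreducible_of_icosahedral` — the hypothesis `hirr` of E1′ is decoration: projective image
  `≅ A₅` (with the finite image of an Artin representation) already forces irreducibility.
* `regAlgCuspidalExist_of_residualBianchiDoorLevel` — E1′ (granted ONE irreducible icosahedral
  `ρ`, so that its `∀ ρ` is not vacuous) yields a regular algebraic cuspidal `π₀` over every 2-split
  imaginary quadratic `K`.
* `not_regAlgCuspidalExist_of_not_residualBianchiDoorLevel` — conversely (contrapositive shape):
  any refutation of E1′ as typed refutes the existence of such `π₀` for some `K` — hopeless, since
  `BC_{K/ℚ}` of any non-CM newform of weight `≥ 2` is one.  Hence E1′ as typed is irrefutable and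
  its Khare–Wintenberger / congruence content is void; the planner's repair is
  `∃ S₀, 2 ∈ S₀ ∧ (∀ ℓ ∈ S₀, ℓ.Prime) ∧ …` (the picked line `Sketch` already returns a prime `S`).
* `not_withoutHirr_of_not_residualBianchiDoorLevel` — mutation: refuting E1′ is the same as refuting
  its `hirr`-free strengthening.
-/

noncomputable section

set_option linter.dupNamespace false

namespace Summit.Langlands.Langlands.Theorems.ResidualBianchiDoorLevel.Negative

open scoped MatrixGroups NumberField
open NumberField IsDedekindDomain Field
open Literature.NumberTheory.Automorphic Literature.NumberTheory.GaloisRepresentations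
  Summit.Langlands.Langlands.Theses.ParityBlindBianchi

/-- **`hirr` is implied by `hA5`**: an Artin representation `ρ : Γ_ℚ → GL₂(ℂ)` has finite image
(`finite_range_toMonoidHom`), and a two-dimensional representation with finite image and non-cyclic
— here icosahedral — projective image is irreducible (`isIrreducible_of_not_isCyclicType`;
Tunnell 1981, p. 173). [folklore] -/
theorem isIrreducible_of_icosahedral (ρ : FramedGaloisRep ℚ ℂ 2)
    (hA5 : Nonempty ((Matrix.ProjGenLinGroup.mk.comp ρ.toMonoidHom).range ≃*
      alternatingGroup (Fin 5))) : ρ.toGaloisRep.IsIrreducible := by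
  haveI : Finite ρ.toMonoidHom.range := finite_range_toMonoidHom ρ
  obtain ⟨e⟩ := hA5
  exact isIrreducible_of_not_isCyclicType ρ.toMonoidHom
    (ResidualBianchiDoorMod2.not_isCyclicType_of_mulEquiv_alternatingGroup e)

/-- **E1′ ⇒ regular algebraic cuspidal representations over every 2-split imaginary quadratic `K`**
(granted one icosahedral `ρ : Γ_ℚ → GL₂(ℂ)` — true, Klein 1884 / Buhler 1978, not constructible in
the tree — and an abstract `ι : ℚ̄₂ ≃+* ℂ`, which exists by Steinitz, cf.
`nonempty_ringEquiv_padicAlgCl_complex` in the sibling file `FalseWithoutIcosahedral`). [folklore] -/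
theorem regAlgCuspidalExist_of_residualBianchiDoorLevel (h : ResidualBianchiDoorLevel)
    (hι : Nonempty (PadicAlgCl 2 ≃+* ℂ))
    (hH : ∃ ρ : FramedGaloisRep ℚ ℂ 2,
      Nonempty ((Matrix.ProjGenLinGroup.mk.comp ρ.toMonoidHom).range ≃* alternatingGroup (Fin 5)))
    (K : Type) [Field K] [NumberField K] (htc : IsTotallyComplex K) (hdeg : Module.finrank ℚ K = 2)
    (hsplit : ∃ v w : HeightOneSpectrum (𝓞 K), v ≠ w ∧ ((2 : ℕ) : 𝓞 K) ∈ v.asIdeal ∧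
      ((2 : ℕ) : 𝓞 K) ∈ w.asIdeal) :
    ∃ (hcpt : isCompact_glFiniteIntegralLevel 2 K) (π₀ : CuspidalAutomorphicRepData 2 K hcpt),
      π₀.1.IsRegularAlgebraic := by
  obtain ⟨ι⟩ := hι
  obtain ⟨ρ, hA5⟩ := hH
  obtain ⟨S₀, -, hK⟩ := h ι ρ (isIrreducible_of_icosahedral ρ hA5) hA5
  obtain ⟨-, -, -, -, -, hcpt, π₀, hRA, -⟩ := hK K htc hdeg hsplit
  exact ⟨hcpt, π₀, hRA⟩

/-- **The loophole (contrapositive shape).**  Any refutation of E1′ as typed is a refutation of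
"every 2-split imaginary quadratic `K` carries a regular algebraic cuspidal automorphic
representation of `GL₂(𝔸_K)`": given the latter, E1′ follows with the junk bad set `S₀ = {2, 0}`
(no good place, vacuous congruence) and the unconditional 2-adic model of `ρ|_K`
(`exists_padicModel_restrictField`).  E1′ as typed is therefore irrefutable, and its
Khare–Wintenberger content is void; repair: restrict `S₀` to primes. [folklore] -/
theorem not_regAlgCuspidalExist_of_not_residualBianchiDoorLevel (h : ¬ ResidualBianchiDoorLevel) :
    ¬ ∀ (K : Type) [Field K] [NumberField K], IsTotallyComplex K → Module.finrank ℚ K = 2 →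
      (∃ v w : HeightOneSpectrum (𝓞 K), v ≠ w ∧ ((2 : ℕ) : 𝓞 K) ∈ v.asIdeal ∧
        ((2 : ℕ) : 𝓞 K) ∈ w.asIdeal) →
      ∃ (hcpt : isCompact_glFiniteIntegralLevel 2 K) (π₀ : CuspidalAutomorphicRepData 2 K hcpt),
        π₀.1.IsRegularAlgebraic := by
  intro hR
  apply h
  intro ι ρ _hirr hA5
  haveI : Fact (Nat.Prime 2) := ⟨Nat.prime_two⟩
  refine ⟨{2, 0}, by simp, ?_⟩
  intro K _ _ htc hdeg hsplit
  obtain ⟨σ₀, -, -, -, hmodel, hfinK, hirrK, hA5K⟩ :=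
    ResidualBianchiDoorMod2.exists_padicModel_restrictField ι ρ hA5 K hdeg
  obtain ⟨hcpt, π₀, hRA⟩ := hR K htc hdeg hsplit
  refine ⟨σ₀.restrictField K, hmodel, hfinK, hirrK, hA5K, hcpt, π₀, hRA, ?_⟩
  intro v hv
  exact (IcosahedralDescentLevel.Negative.no_good_place_of_zero_mem (by simp) K v hv).elim

/-- **Mutation: `hirr` dropped.**  Refuting E1′ is the same as refuting its strengthening with the
irreducibility hypothesis deleted (stated inline), because `hA5 ⇒ hirr`
(`isIrreducible_of_icosahedral`). [folklore] -/
theorem not_withoutHirr_of_not_residualBianchiDoorLevel (h : ¬ ResidualBianchiDoorLevel) :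
    ¬ ∀ (ι : PadicAlgCl 2 ≃+* ℂ) (ρ : FramedGaloisRep ℚ ℂ 2),
      Nonempty ((Matrix.ProjGenLinGroup.mk.comp ρ.toMonoidHom).range ≃* alternatingGroup (Fin 5)) →
      ∃ S₀ : Finset ℕ, 2 ∈ S₀ ∧ ∀ (K : Type) [Field K] [NumberField K], IsTotallyComplex K →
        Module.finrank ℚ K = 2 →
        (∃ v w : HeightOneSpectrum (𝓞 K), v ≠ w ∧ ((2 : ℕ) : 𝓞 K) ∈ v.asIdeal ∧
          ((2 : ℕ) : 𝓞 K) ∈ w.asIdeal) →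
        ∃ σ : FramedGaloisRep K (PadicAlgCl 2) 2,
          (∀ (g : absoluteGaloisGroup K) (i j : Fin 2),
            ι ((σ g).val i j) = ((FramedGaloisRep.restrictField K ρ) g).val i j) ∧
          Finite σ.toMonoidHom.range ∧ σ.toGaloisRep.IsIrreducible ∧
          Nonempty ((Matrix.ProjGenLinGroup.mk.comp σ.toMonoidHom).range ≃*
            alternatingGroup (Fin 5)) ∧
          ∃ (hcpt : isCompact_glFiniteIntegralLevel 2 K)
            (π₀ : CuspidalAutomorphicRepData 2 K hcpt), π₀.1.IsRegularAlgebraic ∧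
            ∀ v : HeightOneSpectrum (𝓞 K), (∀ ℓ ∈ S₀, ((ℓ : ℕ) : 𝓞 K) ∉ v.asIdeal) →
              ∃ (α : Multiset ℂ) (P : Polynomial (PadicAlgCl 2)), π₀.1.HasSatakeParamAt v α ∧
                σ.IsUnramifiedAt v ∧ σ.HasFrobCharpolyAt v P ∧
                ∀ i : ℕ, ‖P.coeff i - (arithFrobPolyOfSatake ι v.residueCard 2 α).coeff i‖ < 1 :=
  fun hW => h fun ι ρ _ hA5 => hW ι ρ hA5

end Summit.Langlands.Langlands.Theorems.ResidualBianchiDoorLevel.Negative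

end
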